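import Summits.HodgeConjecture.HodgeConjecture.Theorems.F0P6aStubDOWNOrgans
import HarnessLib

/-!
# `F0P6aStubDOWNTransport` — ★ RE-HOME of `Lines/F0_P6a_StubDOWN.lean`, PART 6 of 7 (size-lint split; cut at a declaration boundary).

Imports: ★ `Theorems.F0P6aStubDOWNOrgans` = the previous part of the same Lines workfile `F0_P6a_StubDOWN` (size-lint split ×7) + `HarnessLib` (canonical header: bare `import` lines).
See PART 1 `Theorems/F0P6aStubDOWNLaws.lean` for the full re-home header and the original module docstring (verbatim there). Namespaces and sections KEPT
(re-opened below exactly as they stand at the cut, with their `open`∕`variable` lines replayed); code bytes = the workfile՚s, docstrings included; options preamble repeated from PART 1.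
HC_CM is proved only modulo the 7 printed citations (2 remaining: hLiu418 = stmt-HodgeConjecture-24832, h413 = stmt-HodgeConjecture-24833) until rung 0 closes; a re-home is count-neutral. -/

set_option autoImplicit false
set_option linter.dupNamespace false

noncomputable section

namespace Summit.HodgeConjecture.HodgeConjecture.Cruxes.HLiu418.F0P6aStubDOWN
open CategoryTheory CategoryTheory.Limits NumberField IsDedekindDomain MulAction
open scoped Matrix Polynomial Pointwise MonoidalCategory
open Literature.NumberTheory.GaloisRepresentations
open Literature.NumberTheory.Automorphic Literature.NumberTheory.Automorphic.UnitaryGroup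
open Literature.AlgebraicGeometry.ShimuraVarieties.UnitaryCanonicalModel
open Literature.NumberTheory.Automorphic.Liu2021.AppendixC
open Literature.AlgebraicGeometry.Motives (AlgPoints IntegralModel SchemeOver thickening thickeningGalAction thickeningLift specOver relFrobeniusOver frobeniusTwistOver)
open Literature.NumberTheory.DiophantineGeometry (geomResidueField specialFibreFunctor specResidueField)
open Literature.AlgebraicGeometry.RelativeSpec (ActionOver)
open Literature.NumberTheory.EllipticCurves (genericFibre)
open Literature.AlgebraicGeometry.GroupSchemes.AffineGroupScheme (Alg quotIncl)
open Summit.HodgeConjecture.HodgeConjecture.Cruxes.HLiu418.F0P6cDictConstructors (kerFI AdmSub IdealIsEtale isAdm_kerFI)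
open Summit.HodgeConjecture.HodgeConjecture.Cruxes.HLiu418.F0P6aModuliDatumDefs
open Summit.HodgeConjecture.HodgeConjecture.Cruxes.HLiu418.F0P6aRGDAssembly
open Summit.HodgeConjecture.HodgeConjecture.Cruxes.HLiu418.F0P6aDatumOfInputs
open Summit.HodgeConjecture.HodgeConjecture.Cruxes.HLiu418.F0P6aLineSpecialisation (spGeoOf canonicalLine_spGeoOf spGeoOf_surjective hrkG_of_dock
  exists_isogW₀_of_quotLeg mono_coverPin₀ le_ker_isogW₀_of_himg red₀Of_translΩ_eq_of_red₀Of_eq red₀Of_quotΩ_eq_red₀Of_translΩ_of_le_ker_layer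
  red₀Of_quotΩ_eq_of_quotLegReduction₀)  -- [ED. 4] organ heads BY NAME (incl. the §Q head `red₀Of_quotΩ_eq_of_quotLegReduction₀`, PART B)

section Machinery
open scoped MonObj Obj
variable {F : Type} [Field F] [NumberField F] [IsCMField F] {ι₁ : F →+* ℂ}
    {Jstar : Matrix (Fin 2) (Fin 2) F}
    {K₀ : C5.OpenCompactSubgroup ↥(finAdelic ↥(maximalRealSubfield F) F (IsCMField.complexConj F) 2 Jstar)}
    {S : RecordSystemGS F Jstar ι₁ K₀} {hU7ₛ : S.HeckeTranslateDefinedOver}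
    {hJ : (Jstar.map (IsCMField.complexConj F))ᵀ = Jstar} {hJu : IsUnit Jstar}
    {Fi : Type} [Field Fi] [Algebra F Fi] {Kc : C5.SmallLevel K₀} {G : Type} [Group G]
    {𝓜 : IntegralModel (𝓞 F) F ((thickening F Fi).obj (S.M.obj Kc))}
    {w : HeightOneSpectrum (𝓞 F)} {hw : (IsCMField.complexConj F) • w ≠ w} {h𝓨 : (𝓜.localise w).IsSmoothProper 1}
    {θ : ActionOver (𝓜.localise w).total.hom ((Fi ≃ₐ[F] Fi) × G)}
    {e : Fi →ₐ[F] AlgebraicClosure (w.adicCompletion F)}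
variable (hsheets : SheetDecompLaw S Kc 𝓜 w h𝓨 θ e)


/-! #### §C Canonical admissible transport along isomorphisms of `c•w`-layers -/

variable (I : RGDInputsAt F ι₁ Jstar K₀ S hU7ₛ hJ hJu Fi Kc G 𝓜 w hw h𝓨 θ e) [ExpChar (geomResidueField w) I.pChar] (𝔡 : ∀ xbar, DockAt I xbar)

set_option maxHeartbeats 400000 in
/-- **ADMISSIBLE TRANSPORT** of a member of `SubOf I 𝔡 a` along an `𝒪_F`-equivariant isomorphism of group schemes `φ : G₀(a) ⥲ G₀(b)`: the ideal
`Γ(φ)⁻¹ H` (★ `AdmIdealTransport.isHopfIdeal_and_finrank_and_map_le_comap_appTop`). [cite: Tate1997FiniteFlatGroupSchemes, (3.7)] -/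
def transportSub {a b : AlgPoints (𝓜.localise w).reductionAt (geomResidueField w)} (φ : (𝔡 a).G₀ ≅ (𝔡 b).G₀)
    (hφ : letI := (𝔡 a).grp₀; letI := (𝔡 b).grp₀; IsMonHom φ.hom)
    (hφβ : ∀ c : 𝓞 F, (𝔡 a).β₀ c ≫ φ.hom = φ.hom ≫ (𝔡 b).β₀ c) (H : SubOf I 𝔡 a) : SubOf I 𝔡 b :=
  letI := (𝔡 a).grp₀; haveI := (𝔡 a).aff₀; letI := (𝔡 b).grp₀; haveI := (𝔡 b).aff₀; haveI := hφ
  ⟨(H.1.comap φ.hom.left.appTop.hom : Ideal (Alg (𝔡 b).G₀)),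
    Literature.AlgebraicGeometry.GroupSchemes.AdmIdealTransport.isHopfIdeal_and_finrank_and_map_le_comap_appTop φ
      (𝔡 a).β₀ (𝔡 b).β₀ hφβ H.2⟩

set_option maxHeartbeats 400000 in
/-- The ideal of the transported member is `Γ(φ)⁻¹ H`. [cite: Tate1997FiniteFlatGroupSchemes, (3.7)] -/
theorem transportSub_val {a b : AlgPoints (𝓜.localise w).reductionAt (geomResidueField w)} (φ : (𝔡 a).G₀ ≅ (𝔡 b).G₀)
    (hφ : letI := (𝔡 a).grp₀; letI := (𝔡 b).grp₀; IsMonHom φ.hom)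
    (hφβ : ∀ c : 𝓞 F, (𝔡 a).β₀ c ≫ φ.hom = φ.hom ≫ (𝔡 b).β₀ c) (H : SubOf I 𝔡 a) :
    (transportSub I 𝔡 φ hφ hφβ H).1 = (H.1.comap φ.hom.left.appTop.hom : Ideal (Alg (𝔡 b).G₀)) := rfl

set_option maxHeartbeats 400000 in
/-- **THE DICHOTOMY on `SubOf`** (★ (K-b) `eq_kerFI_or_idealIsEtale_of_isAdm` fed with the dock rows of `𝔡 a`, UNFOLDED): a member is the
Frobenius-kernel ideal or étale. [cite: Tate1997FiniteFlatGroupSchemes, (3.7)] [cite: HarrisTaylorAMS2001, Lemma II.2.1] -/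
theorem dichotomy_subOf (a : AlgPoints (𝓜.localise w).reductionAt (geomResidueField w)) (H : SubOf I 𝔡 a) :
    letI := (𝔡 a).grp₀
    H.1 = (RingHom.ker (Literature.AlgebraicGeometry.GroupSchemes.GroupSchemeKernel.kerι
        (relFrobeniusOver I.pChar I.fDeg (𝔡 a).G₀)).left.appTop.hom : Ideal (Alg (𝔡 a).G₀)) ∨
      AlgebraicGeometry.Etale (specOver (geomResidueField w) (Alg (𝔡 a).G₀ ⧸ H.1)).hom := by
  letI := (𝔡 a).grp₀; haveI := (𝔡 a).aff₀; haveI := (𝔡 a).fin₀; letI := (𝔡 a).grpU₀; haveI := (𝔡 a).affU₀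
  haveI : Fact I.pChar.Prime := ⟨I.hpChar.1⟩
  haveI : CharP (geomResidueField w) I.pChar := I.charP₀
  exact Summit.HodgeConjecture.HodgeConjecture.Cruxes.HLiu418.F0P6cDictConstructors.eq_kerFI_or_idealIsEtale_of_isAdm I.pChar I.fDeg (𝔡 a).G₀ (𝔡 a).β₀ (𝔡 a).hβ₀ (𝔡 a).U₀ (𝔡 a).jU₀ (𝔡 a).hU₀ (𝔡 a).NU₀
    (𝔡 a).θU₀ (𝔡 a).hrkF₀ (𝔡 a).hpts₀ (𝔡 a).hsimple₀ H.1 H.2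

set_option maxHeartbeats 400000 in
/-- **CANONICITY: two equivariant layer isomorphisms `G₀(a) ⥲ G₀(b)` transport a member of `SubOf I 𝔡 a` to the SAME member of `SubOf I 𝔡 b`**
(★ (T-can) `comap_appTop_eq_comap_appTop_of_dichotomy`). [cite: Tate1997FiniteFlatGroupSchemes, (3.7)] [cite: SGA3I, VII_A 4.1] -/
theorem transportSub_eq {a b : AlgPoints (𝓜.localise w).reductionAt (geomResidueField w)} (φ ψ : (𝔡 a).G₀ ≅ (𝔡 b).G₀)
    (hφ : letI := (𝔡 a).grp₀; letI := (𝔡 b).grp₀; IsMonHom φ.hom) (hφβ : ∀ c : 𝓞 F, (𝔡 a).β₀ c ≫ φ.hom = φ.hom ≫ (𝔡 b).β₀ c)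
    (hψ : letI := (𝔡 a).grp₀; letI := (𝔡 b).grp₀; IsMonHom ψ.hom) (hψβ : ∀ c : 𝓞 F, (𝔡 a).β₀ c ≫ ψ.hom = ψ.hom ≫ (𝔡 b).β₀ c)
    (H : SubOf I 𝔡 a) : transportSub I 𝔡 φ hφ hφβ H = transportSub I 𝔡 ψ hψ hψβ H := by
  letI := (𝔡 a).grp₀; haveI := (𝔡 a).aff₀; letI := (𝔡 b).grp₀; haveI := (𝔡 b).aff₀; haveI := (𝔡 b).fin₀
  haveI := hφ; haveI := hψ
  exact Subtype.ext (Literature.AlgebraicGeometry.GroupSchemes.AdmIdealTransport.comap_appTop_eq_comap_appTop_of_dichotomy I.pChar I.fDeg φ ψ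
    H.1 (dichotomy_subOf I 𝔡 a H) H.2.2.1 (𝔡 b).hpts₀)

set_option maxHeartbeats 400000 in
/-- **An equivariant layer AUTOMORPHISM fixes every member** (★ (T-can) `comap_appTop_eq_self_of_dichotomy`). [cite: Tate1997FiniteFlatGroupSchemes, (3.7)] -/
theorem transportSub_self {a : AlgPoints (𝓜.localise w).reductionAt (geomResidueField w)} (α : (𝔡 a).G₀ ≅ (𝔡 a).G₀)
    (hα : letI := (𝔡 a).grp₀; IsMonHom α.hom) (hαβ : ∀ c : 𝓞 F, (𝔡 a).β₀ c ≫ α.hom = α.hom ≫ (𝔡 a).β₀ c) (H : SubOf I 𝔡 a) :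
    transportSub I 𝔡 α hα hαβ H = H := by
  letI := (𝔡 a).grp₀; haveI := (𝔡 a).aff₀; haveI := (𝔡 a).fin₀; haveI := hα
  exact Subtype.ext (Literature.AlgebraicGeometry.GroupSchemes.AdmIdealTransport.comap_appTop_eq_self_of_dichotomy I.pChar I.fDeg α H.1
    (dichotomy_subOf I 𝔡 a H) H.2.2.1 (𝔡 a).hpts₀)

set_option maxHeartbeats 400000 in
/-- **COCYCLE-FREENESS: transporting `a → b → c` along any two isomorphisms = transporting `a → c` along any third**
(★ (T-can) `comap_appTop_comap_appTop_eq_of_dichotomy`). [cite: Tate1997FiniteFlatGroupSchemes, (3.7)] -/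
theorem transportSub_transportSub {a b c : AlgPoints (𝓜.localise w).reductionAt (geomResidueField w)}
    (φ : (𝔡 a).G₀ ≅ (𝔡 b).G₀) (χ : (𝔡 b).G₀ ≅ (𝔡 c).G₀) (ω : (𝔡 a).G₀ ≅ (𝔡 c).G₀)
    (hφ : letI := (𝔡 a).grp₀; letI := (𝔡 b).grp₀; IsMonHom φ.hom) (hφβ : ∀ d : 𝓞 F, (𝔡 a).β₀ d ≫ φ.hom = φ.hom ≫ (𝔡 b).β₀ d)
    (hχ : letI := (𝔡 b).grp₀; letI := (𝔡 c).grp₀; IsMonHom χ.hom) (hχβ : ∀ d : 𝓞 F, (𝔡 b).β₀ d ≫ χ.hom = χ.hom ≫ (𝔡 c).β₀ d)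
    (hω : letI := (𝔡 a).grp₀; letI := (𝔡 c).grp₀; IsMonHom ω.hom) (hωβ : ∀ d : 𝓞 F, (𝔡 a).β₀ d ≫ ω.hom = ω.hom ≫ (𝔡 c).β₀ d)
    (H : SubOf I 𝔡 a) :
    transportSub I 𝔡 χ hχ hχβ (transportSub I 𝔡 φ hφ hφβ H) = transportSub I 𝔡 ω hω hωβ H := by
  letI := (𝔡 a).grp₀; haveI := (𝔡 a).aff₀; letI := (𝔡 b).grp₀; haveI := (𝔡 b).aff₀; letI := (𝔡 c).grp₀; haveI := (𝔡 c).aff₀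
  haveI := (𝔡 c).fin₀; haveI := hφ; haveI := hχ; haveI := hω
  exact Subtype.ext (Literature.AlgebraicGeometry.GroupSchemes.AdmIdealTransport.comap_appTop_comap_appTop_eq_of_dichotomy I.pChar I.fDeg φ χ ω
    H.1 (dichotomy_subOf I 𝔡 a H) H.2.2.1 (𝔡 c).hpts₀)

set_option maxHeartbeats 400000 in
/-- Transport along `Iso.refl` is the identity. [cite: Tate1997FiniteFlatGroupSchemes, (3.7)] -/
theorem transportSub_refl {a : AlgPoints (𝓜.localise w).reductionAt (geomResidueField w)}
    (h1 : letI := (𝔡 a).grp₀; IsMonHom (Iso.refl (𝔡 a).G₀).hom) (h1β : ∀ c : 𝓞 F, (𝔡 a).β₀ c ≫ (Iso.refl (𝔡 a).G₀).hom = (Iso.refl (𝔡 a).G₀).hom ≫ (𝔡 a).β₀ c)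
    (H : SubOf I 𝔡 a) : transportSub I 𝔡 (Iso.refl (𝔡 a).G₀) h1 h1β H = H :=
  transportSub_self I 𝔡 (Iso.refl _) h1 h1β H

set_option maxHeartbeats 400000 in
/-- **The Frobenius kernel transports to the Frobenius kernel** (★ `comap_appTop_ker_kerι_relFrobeniusOver`). [cite: SGA3I, VII_A 4.1] -/
theorem transportSub_kerFOf {a b : AlgPoints (𝓜.localise w).reductionAt (geomResidueField w)} (φ : (𝔡 a).G₀ ≅ (𝔡 b).G₀)
    (hφ : letI := (𝔡 a).grp₀; letI := (𝔡 b).grp₀; IsMonHom φ.hom) (hφβ : ∀ c : 𝓞 F, (𝔡 a).β₀ c ≫ φ.hom = φ.hom ≫ (𝔡 b).β₀ c) :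
    transportSub I 𝔡 φ hφ hφβ (kerFOf I 𝔡 a) = kerFOf I 𝔡 b := by
  letI := (𝔡 a).grp₀; haveI := (𝔡 a).aff₀; letI := (𝔡 b).grp₀; haveI := (𝔡 b).aff₀; haveI := hφ
  exact Subtype.ext (Literature.AlgebraicGeometry.GroupSchemes.AdmIdealTransport.comap_appTop_ker_kerι_relFrobeniusOver I.pChar I.fDeg φ)

set_option maxHeartbeats 400000 in
/-- **Étaleness is detected after transport.** [cite: Tate1997FiniteFlatGroupSchemes, (3.7)] -/
theorem isEtaleOf_transportSub_iff {a b : AlgPoints (𝓜.localise w).reductionAt (geomResidueField w)} (φ : (𝔡 a).G₀ ≅ (𝔡 b).G₀)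
    (hφ : letI := (𝔡 a).grp₀; letI := (𝔡 b).grp₀; IsMonHom φ.hom) (hφβ : ∀ c : 𝓞 F, (𝔡 a).β₀ c ≫ φ.hom = φ.hom ≫ (𝔡 b).β₀ c)
    (H : SubOf I 𝔡 a) : IsEtaleOf I 𝔡 (transportSub I 𝔡 φ hφ hφβ H) ↔ IsEtaleOf I 𝔡 H :=
  Literature.AlgebraicGeometry.GroupSchemes.AdmIdealTransport.etale_specOver_quotient_comap_appTop_iff φ H.1

/-! #### §D The layer isomorphisms (choice from `LayerIsoLaw`) and the TRANSPORTED READINGS -/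

variable (hiso : LayerIsoLaw I 𝔡)

set_option maxHeartbeats 400000 in
/-- THE LAYER ISOMORPHISM `G₀(x̄) ⥲ G₀(θ(τ,1)_s x̄)` (choice from `LayerIsoLaw`). [cite: RapoportSmithlingZhang2020Diagonal, Lemma 3.4–Prop. 3.7, pp. 12–14] -/
def layerIso (τ : Fi ≃ₐ[F] Fi) (xbar : AlgPoints (𝓜.localise w).reductionAt (geomResidueField w)) :
    (𝔡 xbar).G₀ ≅ (𝔡 (actOf S Kc 𝓜 w θ τ xbar)).G₀ :=
  (hiso τ xbar).choose

set_option maxHeartbeats 400000 in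
/-- The layer isomorphism is a homomorphism. [cite: RapoportSmithlingZhang2020Diagonal, Lemma 3.4–Prop. 3.7, pp. 12–14] -/
theorem isMonHom_layerIso (τ : Fi ≃ₐ[F] Fi) (xbar : AlgPoints (𝓜.localise w).reductionAt (geomResidueField w)) :
    letI := (𝔡 xbar).grp₀; letI := (𝔡 (actOf S Kc 𝓜 w θ τ xbar)).grp₀; IsMonHom (layerIso I 𝔡 hiso τ xbar).hom :=
  (hiso τ xbar).choose_spec.1

set_option maxHeartbeats 400000 in
/-- The layer isomorphism is `𝒪_F`-equivariant. [cite: RapoportSmithlingZhang2020Diagonal, Lemma 3.4–Prop. 3.7, pp. 12–14] -/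
theorem layerIso_comm (τ : Fi ≃ₐ[F] Fi) (xbar : AlgPoints (𝓜.localise w).reductionAt (geomResidueField w)) (c : 𝓞 F) :
    (𝔡 xbar).β₀ c ≫ (layerIso I 𝔡 hiso τ xbar).hom = (layerIso I 𝔡 hiso τ xbar).hom ≫ (𝔡 (actOf S Kc 𝓜 w θ τ xbar)).β₀ c :=
  (hiso τ xbar).choose_spec.2 c

set_option maxHeartbeats 400000 in
/-- The INVERSE layer isomorphism is a homomorphism. [cite: RapoportSmithlingZhang2020Diagonal, Lemma 3.4–Prop. 3.7, pp. 12–14] -/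
theorem isMonHom_layerIso_inv (τ : Fi ≃ₐ[F] Fi) (xbar : AlgPoints (𝓜.localise w).reductionAt (geomResidueField w)) :
    letI := (𝔡 xbar).grp₀; letI := (𝔡 (actOf S Kc 𝓜 w θ τ xbar)).grp₀; IsMonHom (layerIso I 𝔡 hiso τ xbar).inv := by
  letI := (𝔡 xbar).grp₀; letI := (𝔡 (actOf S Kc 𝓜 w θ τ xbar)).grp₀; haveI := isMonHom_layerIso I 𝔡 hiso τ xbar
  infer_instance

set_option maxHeartbeats 400000 in
/-- The INVERSE layer isomorphism is `𝒪_F`-equivariant (★ `comp_inv_eq_inv_comp_of_comp_hom_eq`). [cite: RapoportSmithlingZhang2020Diagonal, Lemma 3.4–Prop. 3.7, pp. 12–14] -/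
theorem layerIso_inv_comm (τ : Fi ≃ₐ[F] Fi) (xbar : AlgPoints (𝓜.localise w).reductionAt (geomResidueField w)) (c : 𝓞 F) :
    (𝔡 (actOf S Kc 𝓜 w θ τ xbar)).β₀ c ≫ (layerIso I 𝔡 hiso τ xbar).inv =
      (layerIso I 𝔡 hiso τ xbar).inv ≫ (𝔡 xbar).β₀ c :=
  Literature.AlgebraicGeometry.GroupSchemes.IdealKernelLayerIso.comp_inv_eq_inv_comp_of_comp_hom_eq _ (layerIso_comm I 𝔡 hiso τ xbar c)

set_option maxHeartbeats 400000 in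
/-- **D9 `smap` — THE TWIST TRANSPORT** `SubOf x̄ → SubOf (θ(τ,1)_s x̄)` along the layer isomorphism (canonical by §C).
[cite: RapoportSmithlingZhang2020Diagonal, Lemma 3.4–Prop. 3.7, pp. 12–14] -/
def smapT (τ : Fi ≃ₐ[F] Fi) (xbar : AlgPoints (𝓜.localise w).reductionAt (geomResidueField w)) (H : SubOf I 𝔡 xbar) :
    SubOf I 𝔡 (actOf S Kc 𝓜 w θ τ xbar) :=
  transportSub I 𝔡 (layerIso I 𝔡 hiso τ xbar) (isMonHom_layerIso I 𝔡 hiso τ xbar) (layerIso_comm I 𝔡 hiso τ xbar) H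

set_option maxHeartbeats 400000 in
/-- The PULL-BACK of a member to the `e`-sheet representative: `SubOf x̄ → SubOf (base x̄)` (= `smapT (τOf x̄)⁻¹`). [cite: SerreTate1968, §1 Lemma 2] -/
abbrev pullOf (xbar : AlgPoints (𝓜.localise w).reductionAt (geomResidueField w)) (H : SubOf I 𝔡 xbar) :
    SubOf I 𝔡 (actOf S Kc 𝓜 w θ (τOf hsheets xbar)⁻¹ xbar) :=
  smapT I 𝔡 hiso (τOf hsheets xbar)⁻¹ xbar H

variable (quot : ∀ xbar, SubOf I 𝔡 xbar → AlgPoints (𝓜.localise w).reductionAt (geomResidueField w))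
  (transl : AlgPoints (𝓜.localise w).reductionAt (geomResidueField w) → AlgPoints (𝓜.localise w).reductionAt (geomResidueField w))
  (isogW₀ : ∀ xbar (H : SubOf I 𝔡 xbar), (𝔡 xbar).G₀ ⟶ (𝔡 (quot xbar H)).G₀)

set_option maxHeartbeats 400000 in
/-- **D8 TRANSPORTED `quot′ x̄ H := θ(τ,1)_s (quot (base x̄) (pull H))`**, `τ = τOf x̄`. [cite: Liu2021, Prop. D.8 p. 135] -/
abbrev quotT (xbar : AlgPoints (𝓜.localise w).reductionAt (geomResidueField w)) (H : SubOf I 𝔡 xbar) :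
    AlgPoints (𝓜.localise w).reductionAt (geomResidueField w) :=
  actOf S Kc 𝓜 w θ (τOf hsheets xbar) (quot (actOf S Kc 𝓜 w θ (τOf hsheets xbar)⁻¹ xbar) (pullOf hsheets I 𝔡 hiso xbar H))

set_option maxHeartbeats 400000 in
/-- **D8 TRANSPORTED `transl′ x̄ := θ(τ,1)_s (transl (base x̄))`**, `τ = τOf x̄`. [cite: Liu2021, Prop. D.8 p. 135] -/
abbrev translT (xbar : AlgPoints (𝓜.localise w).reductionAt (geomResidueField w)) :
    AlgPoints (𝓜.localise w).reductionAt (geomResidueField w) :=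
  actOf S Kc 𝓜 w θ (τOf hsheets xbar) (transl (actOf S Kc 𝓜 w θ (τOf hsheets xbar)⁻¹ xbar))

set_option maxHeartbeats 400000 in
/-- **K-DATA TRANSPORTED `isogW₀′ x̄ H := φ ≫ isogW₀ (base x̄) (pull H) ≫ ψ`** (`φ` the layer iso to the representative, `ψ` the layer iso from
`quot (base x̄) (pull H)` to its `θ(τ,1)_s`-translate = `quot′ x̄ H` on the nose). [cite: Liu2021, p. 137] -/
abbrev isogT (xbar : AlgPoints (𝓜.localise w).reductionAt (geomResidueField w)) (H : SubOf I 𝔡 xbar) :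
    (𝔡 xbar).G₀ ⟶ (𝔡 (quotT hsheets I 𝔡 hiso quot xbar H)).G₀ :=
  (layerIso I 𝔡 hiso (τOf hsheets xbar)⁻¹ xbar).hom ≫ isogW₀ (actOf S Kc 𝓜 w θ (τOf hsheets xbar)⁻¹ xbar) (pullOf hsheets I 𝔡 hiso xbar H) ≫
    (layerIso I 𝔡 hiso (τOf hsheets xbar) (quot (actOf S Kc 𝓜 w θ (τOf hsheets xbar)⁻¹ xbar) (pullOf hsheets I 𝔡 hiso xbar H))).hom

/-! #### §E The nine rows -/

set_option maxHeartbeats 400000 in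
/-- KEY REWRITE for `quot′`: if `τOf x̄ = σ` and `actOf σ⁻¹ x̄ = b`, then `quot′ x̄ H = actOf σ (quot b (Γ(ψ)⁻¹ H))` for ANY equivariant layer iso
`ψ : G₀(x̄) ⥲ G₀(b)` (the dependent data are generalised away by `subst`, the iso by canonicity §C). [cite: Liu2021, Prop. D.8 p. 135] -/
theorem quotT_eq_of (xbar : AlgPoints (𝓜.localise w).reductionAt (geomResidueField w)) {σ : Fi ≃ₐ[F] Fi}
    (hσ : τOf hsheets xbar = σ) {b : AlgPoints (𝓜.localise w).reductionAt (geomResidueField w)} (hb : actOf S Kc 𝓜 w θ σ⁻¹ xbar = b)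
    (ψ : (𝔡 xbar).G₀ ≅ (𝔡 b).G₀) (hψ : letI := (𝔡 xbar).grp₀; letI := (𝔡 b).grp₀; IsMonHom ψ.hom)
    (hψβ : ∀ c : 𝓞 F, (𝔡 xbar).β₀ c ≫ ψ.hom = ψ.hom ≫ (𝔡 b).β₀ c) (H : SubOf I 𝔡 xbar) :
    quotT hsheets I 𝔡 hiso quot xbar H = actOf S Kc 𝓜 w θ σ (quot b (transportSub I 𝔡 ψ hψ hψβ H)) := by
  subst hσ
  subst hb
  exact congrArg (fun H' => actOf S Kc 𝓜 w θ (τOf hsheets xbar) (quot (actOf S Kc 𝓜 w θ (τOf hsheets xbar)⁻¹ xbar) H'))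
    (transportSub_eq I 𝔡 (layerIso I 𝔡 hiso (τOf hsheets xbar)⁻¹ xbar) ψ (isMonHom_layerIso I 𝔡 hiso _ xbar)
      (layerIso_comm I 𝔡 hiso _ xbar) hψ hψβ H)

set_option maxHeartbeats 400000 in
/-- KEY REWRITE for `transl′`: if `τOf x̄ = σ` then `transl′ x̄ = actOf σ (transl (actOf σ⁻¹ x̄))`. [cite: Liu2021, Prop. D.8 p. 135] -/
theorem translT_eq_of (xbar : AlgPoints (𝓜.localise w).reductionAt (geomResidueField w)) {σ : Fi ≃ₐ[F] Fi}
    (hσ : τOf hsheets xbar = σ) :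
    translT hsheets transl xbar = actOf S Kc 𝓜 w θ σ (transl (actOf S Kc 𝓜 w θ σ⁻¹ xbar)) := by
  subst hσ
  rfl

set_option maxHeartbeats 400000 in
/-- **(c2) ROW `red_translΩ`** for the transported `transl′`: on the `e`-sheet `transl′ = transl` (`τOf (red₀ y) = 1`), then `RedTranslLaw`.
[cite: Liu2021, p. 137] -/
theorem red_translΩ_translT (hdisj : SheetDisjoint S Kc 𝓜 w h𝓨 θ e)
    {translΩ : AlgPoints (S.M.obj Kc) (AlgebraicClosure (w.adicCompletion F)) → AlgPoints (S.M.obj Kc) (AlgebraicClosure (w.adicCompletion F))}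
    (hrt : RedTranslLaw S Kc 𝓜 w h𝓨 e translΩ transl) (y : AlgPoints (S.M.obj Kc) (AlgebraicClosure (w.adicCompletion F))) :
    red₀Of S Kc 𝓜 w h𝓨 e (translΩ y) = translT hsheets transl (red₀Of S Kc 𝓜 w h𝓨 e y) := by
  rw [translT_eq_of hsheets transl _ (τOf_red₀Of hsheets hdisj y), inv_one, actOf_one, actOf_one]
  exact hrt y

set_option maxHeartbeats 400000 in
/-- **(c2) ROW `red_quotΩ`** for the transported `quot′`: on the `e`-sheet `quot′ = quot` (`τOf (red₀ y) = 1`, transport along `Iso.refl` by canonicity),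
then `RedQuotLaw`. [cite: Liu2021, p. 137] -/
theorem red_quotΩ_quotT (hdisj : SheetDisjoint S Kc 𝓜 w h𝓨 θ e)
    {quotΩ : ∀ y, LineOf I y → AlgPoints (S.M.obj Kc) (AlgebraicClosure (w.adicCompletion F))}
    {sp : ∀ y, LineOf I y → SubOf I 𝔡 (red₀Of S Kc 𝓜 w h𝓨 e y)}
    (hrq : RedQuotLaw I 𝔡 quotΩ sp quot) (y : AlgPoints (S.M.obj Kc) (AlgebraicClosure (w.adicCompletion F))) (L : LineOf I y) :
    red₀Of S Kc 𝓜 w h𝓨 e (quotΩ y L) = quotT hsheets I 𝔡 hiso quot (red₀Of S Kc 𝓜 w h𝓨 e y) (sp y L) := by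
  letI := (𝔡 (red₀Of S Kc 𝓜 w h𝓨 e y)).grp₀
  have h1 : IsMonHom (Iso.refl (𝔡 (red₀Of S Kc 𝓜 w h𝓨 e y)).G₀).hom := inferInstanceAs (IsMonHom (𝟙 _))
  have h1β : ∀ c : 𝓞 F, (𝔡 (red₀Of S Kc 𝓜 w h𝓨 e y)).β₀ c ≫ (Iso.refl (𝔡 (red₀Of S Kc 𝓜 w h𝓨 e y)).G₀).hom =
      (Iso.refl (𝔡 (red₀Of S Kc 𝓜 w h𝓨 e y)).G₀).hom ≫ (𝔡 (red₀Of S Kc 𝓜 w h𝓨 e y)).β₀ c := fun c => by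
    rw [Iso.refl_hom, Category.comp_id, Category.id_comp]
  have hb : actOf S Kc 𝓜 w θ (1 : Fi ≃ₐ[F] Fi)⁻¹ (red₀Of S Kc 𝓜 w h𝓨 e y) = red₀Of S Kc 𝓜 w h𝓨 e y := by
    rw [inv_one, actOf_one]
  rw [quotT_eq_of hsheets I 𝔡 hiso quot _ (τOf_red₀Of hsheets hdisj y) hb (Iso.refl _) h1 h1β, transportSub_refl, actOf_one]
  exact hrq y L

set_option maxHeartbeats 400000 in
/-- **D9 ROW `smap_kerF`**: the twist transport fixes the Frobenius kernel. [cite: SGA3I, VII_A 4.1] -/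
theorem smapT_kerFOf (τ : Fi ≃ₐ[F] Fi) (xbar : AlgPoints (𝓜.localise w).reductionAt (geomResidueField w)) :
    smapT I 𝔡 hiso τ xbar (kerFOf I 𝔡 xbar) = kerFOf I 𝔡 (actOf S Kc 𝓜 w θ τ xbar) :=
  transportSub_kerFOf I 𝔡 _ _ _

set_option maxHeartbeats 400000 in
/-- The layer isomorphism from a TRANSLATE straight to the `e`-sheet representative: `G₀(θ(τ)x̄) ⥲ G₀(x̄) ⥲ G₀(base x̄)`.
[cite: RapoportSmithlingZhang2020Diagonal, Lemma 3.4–Prop. 3.7, pp. 12–14] -/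
def isoToBase (τ : Fi ≃ₐ[F] Fi) (xbar : AlgPoints (𝓜.localise w).reductionAt (geomResidueField w)) :
    (𝔡 (actOf S Kc 𝓜 w θ τ xbar)).G₀ ≅ (𝔡 (base hsheets xbar)).G₀ :=
  (layerIso I 𝔡 hiso τ xbar).symm ≪≫ layerIso I 𝔡 hiso (τOf hsheets xbar)⁻¹ xbar

set_option maxHeartbeats 400000 in
/-- `isoToBase` is a homomorphism. [cite: RapoportSmithlingZhang2020Diagonal, Lemma 3.4–Prop. 3.7, pp. 12–14] -/
theorem isMonHom_isoToBase (τ : Fi ≃ₐ[F] Fi) (xbar : AlgPoints (𝓜.localise w).reductionAt (geomResidueField w)) :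
    letI := (𝔡 (actOf S Kc 𝓜 w θ τ xbar)).grp₀; letI := (𝔡 (base hsheets xbar)).grp₀; IsMonHom (isoToBase hsheets I 𝔡 hiso τ xbar).hom := by
  letI := (𝔡 xbar).grp₀; letI := (𝔡 (actOf S Kc 𝓜 w θ τ xbar)).grp₀; letI := (𝔡 (base hsheets xbar)).grp₀
  haveI := isMonHom_layerIso_inv I 𝔡 hiso τ xbar
  haveI := isMonHom_layerIso I 𝔡 hiso (τOf hsheets xbar)⁻¹ xbar
  exact inferInstanceAs (IsMonHom ((layerIso I 𝔡 hiso τ xbar).inv ≫ (layerIso I 𝔡 hiso (τOf hsheets xbar)⁻¹ xbar).hom))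

set_option maxHeartbeats 400000 in
/-- Unfolding `isoToBase`: its `hom` is `(layerIso τ x̄)⁻¹ ≫ layerIso (τOf x̄)⁻¹ x̄`. [cite: RapoportSmithlingZhang2020Diagonal, Lemma 3.4–Prop. 3.7, pp. 12–14] -/
theorem isoToBase_hom (τ : Fi ≃ₐ[F] Fi) (xbar : AlgPoints (𝓜.localise w).reductionAt (geomResidueField w)) :
    (isoToBase hsheets I 𝔡 hiso τ xbar).hom = (layerIso I 𝔡 hiso τ xbar).inv ≫ (layerIso I 𝔡 hiso (τOf hsheets xbar)⁻¹ xbar).hom := rfl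

set_option maxHeartbeats 400000 in
/-- `isoToBase` is `𝒪_F`-equivariant (term-mode with explicit associators; `rw`∕implicit associators hang on dock goals). [cite: RapoportSmithlingZhang2020Diagonal, Lemma 3.4–Prop. 3.7, pp. 12–14] -/
theorem isoToBase_comm (τ : Fi ≃ₐ[F] Fi) (xbar : AlgPoints (𝓜.localise w).reductionAt (geomResidueField w)) (c : 𝓞 F) :
    (𝔡 (actOf S Kc 𝓜 w θ τ xbar)).β₀ c ≫ (isoToBase hsheets I 𝔡 hiso τ xbar).hom =
      (isoToBase hsheets I 𝔡 hiso τ xbar).hom ≫ (𝔡 (base hsheets xbar)).β₀ c := by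
  -- DAYLIGHT HEAD-ROOM CURE (LA2-p04 (g7), proof body only; statement, binders, budget byte-identical): the two served `𝒪_F`-squares
  -- `layerIso_inv_comm` ∕ `layerIso_comm` pasted by Mathlib՚s `CommSq.horiz_comp` and moved onto `(isoToBase …).hom` along `isoToBase_hom` by
  -- `congrArg`∕`Eq.trans` (first-order unification only).  The former `isoToBase_hom ▸ e3` cast abstracted the motive over dock-sized types
  -- (`kabstract`): 364 161 → 14 614 heartbeat units measured by import (HOME probe `hb/IsoToBaseComm.hbprobe.v2{A,E}`), i.e. 91 % → 3.7 % of 400 000.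
  exact (congrArg ((𝔡 (actOf S Kc 𝓜 w θ τ xbar)).β₀ c ≫ ·) (isoToBase_hom hsheets I 𝔡 hiso τ xbar)).trans
    (((CommSq.mk (layerIso_inv_comm I 𝔡 hiso τ xbar c).symm).horiz_comp
        (CommSq.mk (layerIso_comm I 𝔡 hiso (τOf hsheets xbar)⁻¹ xbar c).symm)).w.symm.trans
      (congrArg (· ≫ (𝔡 (base hsheets xbar)).β₀ c) (isoToBase_hom hsheets I 𝔡 hiso τ xbar).symm))

set_option maxHeartbeats 400000 in
/-- Pulling a twisted member back to the representative = pulling the member itself back (cocycle-freeness §C).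
[cite: Tate1997FiniteFlatGroupSchemes, (3.7)] -/
theorem transportSub_isoToBase_smapT (τ : Fi ≃ₐ[F] Fi) (xbar : AlgPoints (𝓜.localise w).reductionAt (geomResidueField w))
    (H : SubOf I 𝔡 xbar) :
    transportSub I 𝔡 (isoToBase hsheets I 𝔡 hiso τ xbar) (isMonHom_isoToBase hsheets I 𝔡 hiso τ xbar) (isoToBase_comm hsheets I 𝔡 hiso τ xbar)
        (smapT I 𝔡 hiso τ xbar H) = pullOf hsheets I 𝔡 hiso xbar H :=
  transportSub_transportSub I 𝔡 (layerIso I 𝔡 hiso τ xbar) (isoToBase hsheets I 𝔡 hiso τ xbar) (layerIso I 𝔡 hiso (τOf hsheets xbar)⁻¹ xbar)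
    (isMonHom_layerIso I 𝔡 hiso τ xbar) (layerIso_comm I 𝔡 hiso τ xbar) (isMonHom_isoToBase hsheets I 𝔡 hiso τ xbar)
    (isoToBase_comm hsheets I 𝔡 hiso τ xbar) (isMonHom_layerIso I 𝔡 hiso _ xbar) (layerIso_comm I 𝔡 hiso _ xbar) H

set_option maxHeartbeats 400000 in
/-- **D9 ROW `quot_smap`**: `quot′ (θ x̄) (smap H) = θ (quot′ x̄ H)` — `τOf (θ x̄) = τ · τOf x̄`, same representative, and the two transports to the
representative agree by cocycle-freeness §C. [cite: RapoportSmithlingZhang2020Diagonal, Lemma 3.4–Prop. 3.7, pp. 12–14] -/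
theorem quotT_smapT (hdisj : SheetDisjoint S Kc 𝓜 w h𝓨 θ e) (τ : Fi ≃ₐ[F] Fi)
    (xbar : AlgPoints (𝓜.localise w).reductionAt (geomResidueField w)) (H : SubOf I 𝔡 xbar) :
    quotT hsheets I 𝔡 hiso quot (actOf S Kc 𝓜 w θ τ xbar) (smapT I 𝔡 hiso τ xbar H) =
      actOf S Kc 𝓜 w θ τ (quotT hsheets I 𝔡 hiso quot xbar H) := by
  have hσ : τOf hsheets (actOf S Kc 𝓜 w θ τ xbar) = τ * τOf hsheets xbar := τOf_actOf hsheets hdisj τ xbar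
  have hb : actOf S Kc 𝓜 w θ (τ * τOf hsheets xbar)⁻¹ (actOf S Kc 𝓜 w θ τ xbar) = base hsheets xbar := by
    rw [mul_inv_rev, actOf_mul, actOf_inv_actOf]
  rw [quotT_eq_of hsheets I 𝔡 hiso quot _ hσ hb (isoToBase hsheets I 𝔡 hiso τ xbar) (isMonHom_isoToBase hsheets I 𝔡 hiso τ xbar)
    (isoToBase_comm hsheets I 𝔡 hiso τ xbar), transportSub_isoToBase_smapT, actOf_mul]

set_option maxHeartbeats 400000 in
/-- **K-DATA ROW `IsogHomLaw`** for the transported layer maps (a composite of three homomorphisms). [cite: Liu2021, p. 137] -/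
theorem isogHomLaw_isogT (hhom : IsogHomLaw I 𝔡 quot isogW₀) : IsogHomLaw I 𝔡 (quotT hsheets I 𝔡 hiso quot) (isogT hsheets I 𝔡 hiso quot isogW₀) := by
  intro xbar H
  letI := (𝔡 xbar).grp₀; letI := (𝔡 (base hsheets xbar)).grp₀
  letI := (𝔡 (quot (base hsheets xbar) (pullOf hsheets I 𝔡 hiso xbar H))).grp₀
  letI := (𝔡 (quotT hsheets I 𝔡 hiso quot xbar H)).grp₀
  haveI := isMonHom_layerIso I 𝔡 hiso (τOf hsheets xbar)⁻¹ xbar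
  haveI := isMonHom_layerIso I 𝔡 hiso (τOf hsheets xbar) (quot (base hsheets xbar) (pullOf hsheets I 𝔡 hiso xbar H))
  haveI : IsMonHom (isogW₀ (base hsheets xbar) (pullOf hsheets I 𝔡 hiso xbar H)) := hhom _ _
  exact inferInstanceAs (IsMonHom (_ ≫ _ ≫ _))

/-! ##### (E8) — the transported kills-law: ★ `HopfIdealTransportFactor` (LA6-p01 (g2), p849016) generic factorisation `V(I) ↪ G —φ→ G′` through `V(Γ(φ)⁻¹ I)` -/

set_option maxHeartbeats 400000 in
/-- **(E8) `IsogKerLaw` TRANSPORTED** (abstract binders; text of LA6-p01 (g2) d5ac859d): if the sheet layer map kills the pulled-back member,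
`quotIncl (𝔡 b).G₀ Hb.1 ≫ isogW₀ = 1` with `Hb.1 = Γ(φ)⁻¹ H.1`, then the conjugated layer map kills `H`: `quotIncl (𝔡 a).G₀ H.1 ≫ (φ.hom ≫ isogW₀ ≫ ψ.hom) = 1`.
No homomorphism ∕ equivariance hypothesis on `φ` is used. [cite: GortzWedhorn2023, (27.1.1) and §(27.2) (p. 607)] [cite: Liu2021, p. 137] -/
theorem isogKerLaw_transport {a b q q' : AlgPoints (𝓜.localise w).reductionAt (geomResidueField w)}
    (φ : (𝔡 a).G₀ ≅ (𝔡 b).G₀) (isogW₀' : (𝔡 b).G₀ ⟶ (𝔡 q).G₀)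
    (ψ : (𝔡 q).G₀ ≅ (𝔡 q').G₀) (hψ : letI := (𝔡 q).grp₀; letI := (𝔡 q').grp₀; IsMonHom ψ.hom)
    (H : SubOf I 𝔡 a) (Hb : SubOf I 𝔡 b) (hHb : Hb.1 = (H.1.comap φ.hom.left.appTop.hom : Ideal (Alg (𝔡 b).G₀)))
    (hker : letI := (𝔡 b).grp₀; haveI := (𝔡 b).aff₀; letI := (𝔡 q).grp₀; quotIncl (𝔡 b).G₀ Hb.1 ≫ isogW₀' = 1) :
    letI := (𝔡 a).grp₀; haveI := (𝔡 a).aff₀; letI := (𝔡 q').grp₀; quotIncl (𝔡 a).G₀ H.1 ≫ (φ.hom ≫ isogW₀' ≫ ψ.hom) = 1 := by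
  letI := (𝔡 a).grp₀; haveI := (𝔡 a).aff₀; letI := (𝔡 b).grp₀; haveI := (𝔡 b).aff₀; letI := (𝔡 q).grp₀; letI := (𝔡 q').grp₀
  haveI := hψ
  obtain ⟨J, hJ⟩ := Hb
  dsimp only at hHb hker
  subst hHb
  exact Literature.AlgebraicGeometry.GroupSchemes.AdmIdealTransport.quotIncl_comp_comp_eq_one_of_comap φ.hom H.1 isogW₀' ψ.hom hker

set_option maxHeartbeats 400000 in
/-- **(E8) TRANSPORTED, CONCLUSION AT A NAMED ARROW** `k = φ.hom ≫ isogW₀ ≫ ψ.hom`: the same kills-statement for any arrow `k`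
EQUAL to the conjugate (so that the dock-level instance is obtained at `k := isogT x̄ H` with `rfl`, and the kernel re-check of the
law body is syntactic). [cite: GortzWedhorn2023, (27.1.1) and §(27.2) (p. 607)] [cite: Liu2021, p. 137] -/
theorem isogKerLaw_transport_of_eq {a b q q' : AlgPoints (𝓜.localise w).reductionAt (geomResidueField w)}
    (φ : (𝔡 a).G₀ ≅ (𝔡 b).G₀) (isogW₀' : (𝔡 b).G₀ ⟶ (𝔡 q).G₀)
    (ψ : (𝔡 q).G₀ ≅ (𝔡 q').G₀) (hψ : letI := (𝔡 q).grp₀; letI := (𝔡 q').grp₀; IsMonHom ψ.hom)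
    (H : SubOf I 𝔡 a) (Hb : SubOf I 𝔡 b) (hHb : Hb.1 = (H.1.comap φ.hom.left.appTop.hom : Ideal (Alg (𝔡 b).G₀)))
    (hker : letI := (𝔡 b).grp₀; haveI := (𝔡 b).aff₀; letI := (𝔡 q).grp₀; quotIncl (𝔡 b).G₀ Hb.1 ≫ isogW₀' = 1)
    (k : (𝔡 a).G₀ ⟶ (𝔡 q').G₀) (hk : k = φ.hom ≫ isogW₀' ≫ ψ.hom) :
    letI := (𝔡 a).grp₀; haveI := (𝔡 a).aff₀; letI := (𝔡 q').grp₀; quotIncl (𝔡 a).G₀ H.1 ≫ k = 1 := by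
  subst hk
  exact isogKerLaw_transport I 𝔡 φ isogW₀' ψ hψ H Hb hHb hker

end Machinery
end Summit.HodgeConjecture.HodgeConjecture.Cruxes.HLiu418.F0P6aStubDOWN
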